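import Literature.Probability.Percolation.MarkedLoopLawAttachSplit
import Literature.Probability.Percolation.MarkedLoopPendantTwoRoots
import Literature.Probability.Percolation.MarkedLoopPatternContract
import Literature.Probability.Percolation.MarkedLoopBoundaryLawMass
import Literature.Probability.Percolation.KhSThreeDisorderNormalisation
import HarnessLib

/-!
# Attaching a whole outer path between two corner faces: the present part of the boundary law is the CONTRACTION of the law with two more marks — F2 («LAW-CONTRACT»)

Topic `Literature/Probability/Percolation`; the second half of the lane's surgery identity F2 for Khristoforov–Smirnov boundary link-pattern laws, assembled from
`MarkedLoopLawAttachSplit.lean` («LAW-ATTACH-SPLIT»: `AttachData D' D h r m` — ONE UNMARKED HEXAGON `h` attached to `G` along the contact arc `k > m`, outer run `k ≤ m`;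
`nbond_mem_iff_of_mem_TXb` the all-or-nothing walk; `patternCount_eq_add_present`: `N^{D'}_p = N^{D}_p + N^{D', present}_p`), `MarkedLoopPendantTwoRoots.lean`
(«PENDANT-TWO-ROOTS»: `reachable_union_pendant₂_iff` — attaching a path between two root faces identifies them in the link relation), `MarkedLoopPatternContract.lean`
(«PAT-CONTRACT»: `Pat₀.contract j`, its closed forms `Pat₀.mem_contract_iff` / `Pat₀.contract_partner_eq_iff`, and the law assembly `lawLP_eq_add_contractL`),
`MarkedLoopLawSlide.lean` (#848: `nbond`, `SlideData.odd_xiDeg_N_iff`, `SlideData.adj_N_succ`, `eq_N_or_of_inc`, `xiDeg_union_of_disjoint`, …),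
`MarkedLoopBoundaryLawMass.lean` («LAWPOINT-MASS»: `patternCount_eq_zero_of_not_mem_outAt`) and `KhSThreeDisorderNormalisation.lean` (`existsUnique_inClassX`).

THE IDENTITY (F2 of HOME `FINDING-BSPAN-TOWER-IDENTITY.md`, in Pearce–Rittenberg–de Gier–Nienhuis's planar Temperley–Lieb module): for `D = (Ω; M̂)` with `k` marks, `D' = (Ω ∪ h; M̂)`
(the hexagon `h` attached with no mark on it) and `E = (Ω; M̂ + P + Q)` the small domain marked additionally at the two END FACES `P = N_{r+5}`, `Q = N_{r+m}` of the outer path of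
`h`, inserted as adjacent corners `j, j+1`,
  `lawLP z' = lawLP z + contractL j (lawLP z_E)`
at every mid-edge `z` of the common home arc (`AttachData.lawLP_eq_add_contractL_lawLP`). Mechanism (Khristoforov–Smirnov §1.2: a loop configuration with prescribed boundary
disorders is a union of disjoint paths matching the marked points; Pearce–Rittenberg–de Gier–Nienhuis §2: the contraction half of `e_j` joins the two strands at `j, j+1`):
a configuration of `D'` either avoids the new bonds at `h` (then it is a configuration of `D`, same pattern — car «LAW-ATTACH-SPLIT») or contains ALL of them (the all-or-nothing
walk); deleting them flips the parity exactly at the two end faces `P`, `Q` (`odd_xiDeg_EN_iff`), so the rest is a configuration of `E`; and since the deleted path joins `P` to `Q`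
(`EN_reachable`), the link relation / partner of the big configuration is the two-root disjunction of the small one (`reachable_union_EN_iff`), i.e. LITERALLY the closed form of
`Pat₀.contract j` (`inClassX_union_EN_iff`, `linkRel_union_EN_eq`).

* `EN h r m` — the whole set of new bonds `nb k = s(h, h + e_{r+k})`, `k ≤ m`; `mem_EN_iff`, `nbond_mem_EN_iff`, ★ `odd_xiDeg_EN_iff` (odd exactly at `k = m` and `k = 5`),
  ★ `EN_reachable` (joins `N_{r+5}` to every `N_{r+k}`, `k ≤ m`), `EN_faces`;
* `MarksData D E h r m j` — **THE TWO-MORE-MARKS DATA** (`E.verts = D.verts`, `yc E (skip j i) = yc D i`, `{yc E j, yc E (j+1)} = {N_{r+5}, N_{r+m}}` in either order);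
  `MarksData.hBonds_eq`, ★ `MarksData.mem_corners_iff` (`corners E = corners D ∪ {P, Q}`), `MarksData.endFace_not_corner`; `eq_castSucc_or_succ_or_skip`;
* `AttachData.disjoint_EN`, `EN_subset'`, `not_mem_outer_of_touching`, `pendant₂` (the two-root pendant hypotheses), ★★ `AttachData.reachable_union_EN_iff` (links after
  attaching the whole path: `X ~ Y ∨ (X ~ P ∧ Q ~ Y) ∨ (X ~ Q ∧ P ~ Y)`), ★ `odd_xiDeg_EN_iff_face`;
* ★★ `AttachData.parityIs_union_EN_iff`, ★★ `AttachData.union_EN_mem_TXb_iff` (`ξ ∪ EN ∈ W^{D'}_z(s) ↔ ξ ∈ W^{E}_z(s)` for `ξ ⊆ H_G`), `eq_filter_union_EN` (restriction, by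
  the all-or-nothing walk), `filter_union_EN_eq`;
* `reachable_union_EN_iff'` (end faces by corner index), `reachable_yc_iff`, `reachable_s_yc_iff` (class uniqueness), ★★★ `AttachData.inClassX_union_EN_iff` — **the partner of
  `ξ ∪ EN` in `D'` is the partner of `q.contract j`**, ★★★ `AttachData.linkRel_union_EN_eq` — **the link relation of `ξ ∪ EN` in `D'` is that of `q.contract j`** (for `ξ` of
  outermost `E`-pattern `q`);
* ★ `exists_pat₀_of_mem_TXb` — at a boundary mid-edge of the home arc EVERY configuration realises an OUTERMOST pattern (class uniqueness + `isPattern_linkRel` + the arc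
  law), `pat₀_unique_of_mem_TXb`;
* ★★★ `AttachData.card_present_eq_sum` — **the present configurations with pattern `p` biject (delete the path) with the configurations of `E` whose outermost pattern
  contracts to `p`**; ★★★ `AttachData.presentCount_eq_sum` — `N^{D', present}_p = Σ_{q : q.contract j = p} N^{E}_q`;
* ★★★★ `AttachData.lawLP_eq_add_contractL_lawLP` — **F2: `lawLP z' = lawLP z + contractL ℂ (castSucc j) (lawLP z_E)`**.

What F2 is for: with the SLIDE identity (#848) and the cap-insertion criterion (`MarkedLoopBoundarySpanCapIns`) it is the BR-compatible surgery algebra by which the lane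
attacks BSPAN(k) by induction on domains (HOME `FINDING-BSPAN-TOWER-IDENTITY.md`, `FINDING-TWO-CELL-CAP-IDENTITY.md`); the existence of `E` as a `TriMarkedDomain` with the
prescribed corner order (a `TriMarkedDomainOfDarts`-style constructor, as `MarkedLoopLawSlideOfDarts` does for the SLIDE) is typed separately.

## References
* M. Khristoforov, S. Smirnov, *Percolation and O(1) loop model*, arXiv:2111.15612v1 (2021), §1.2 (p. 2: loop configurations with boundary disorders, «IP(ξ) is a union of
  disjoint paths, matching marked points», the law of the link pattern), §2 Definition 3 (p. 4: the events `z ↔ u_j`), eq. (4) (p. 5).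
* P. A. Pearce, V. Rittenberg, J. de Gier, B. Nienhuis, *Temperley–Lieb stochastic processes*, J. Phys. A 35 (2002) L661–L668, §2 ((monoid): the contraction at `j, j+1`;
  the link-pattern module).
* B. Bollobás, O. Riordan, *Percolation*, Cambridge University Press 2006, Ch. 7 §7.2.2 pp. 168–169 (discrete domains of the hexagonal lattice, attaching hexagons along the
  boundary).

## Mathlib / tree
Tree: the five modules above and `MarkedLoopSpace` (`yc_injective`, `mem_corners`, `yc_mem_touching`, `mem_touching_of_side_mem`, `mem_triFacesTouching`,
`RemovableAt.hexFaceVertices_leftFaceDir`), `MarkedLoopHolomorphy` (`hBonds_eq_of_verts_eq'`, `mem_linkRel`), `KhSThreeDisorderObservable` (`mem_TXb_iff`, `ParityIs`,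
`hbK_inClassX_iff`), `FivePointNormalisation` (`xiLinked_iff_reachable`, `l1_xiDeg_eq`), `MarkedLoopTripodBasis` (`isPattern_linkRel`, `IsPattern.symm/irrefl/partner_eq`,
`Pat₀`, `patternCount`), `MarkedLoopBoundaryLawModule` (`mem_outAt_last_iff`), `MarkedLoopBoundarySpan` (`ArcPoint`), `LatticeModels/TemperleyLiebCapContract` (`skip`,
`unskip`, `skip_unskip`, `skip_ne_castSucc/succ`, `skip_injective`, `contractL`). Mathlib: `Finset.card_bij`, `Finset.card_biUnion`, `Finset.sum_add_distrib`, `Nat.odd_add`.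
-/


namespace Literature.Probability.Percolation.MarkedLoops

open Literature.Probability.Percolation Literature.Probability.LatticeModels
open Literature.Probability.LatticeModels.TemperleyLieb
open Literature.Probability.Percolation.FivePoint (side side_injective XiLinked Inc inc_side inc_mk_iff xiDeg)
open Literature.Probability.Percolation.FivePoint.N5 (sideGraph side_oppFace_oppIdx xiLinked_iff_reachable l1_xiDeg_eq ht2_sideGraph_mono)
open TriMarkedDomain Finset

section Contract

variable {nm : ℕ}

/-! ### The whole outer path as a set of new bonds -/

/-- **the new bonds of the attached hexagon**: `nb k = s(h, h + e_{r+k})`, `k ≤ m`. [cite: KhristoforovSmirnov2021, §1.2 (arXiv v1 p. 2)] -/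
def EN (h : Site 2) (r m : Fin 6) : Finset (Sym2 (Site 2)) :=
  ((Finset.univ : Finset (Fin 6)).filter fun k => k ≤ m).image fun k => nbond h (r + k)

/-- membership in `EN`. [cite: KhristoforovSmirnov2021, §1.2 (arXiv v1 p. 2)] -/
theorem mem_EN_iff {h : Site 2} {r m : Fin 6} {b : Sym2 (Site 2)} : b ∈ EN h r m ↔ ∃ k : Fin 6, k ≤ m ∧ b = nbond h (r + k) := by
  unfold EN
  rw [Finset.mem_image]
  constructor
  · rintro ⟨k, hk, rfl⟩; exact ⟨k, (Finset.mem_filter.1 hk).2, rfl⟩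
  · rintro ⟨k, hk, rfl⟩; exact ⟨k, Finset.mem_filter.2 ⟨Finset.mem_univ _, hk⟩, rfl⟩

/-- `nb k ∈ EN ↔ k ≤ m`. [cite: KhristoforovSmirnov2021, §1.2 (arXiv v1 p. 2)] -/
theorem nbond_mem_EN_iff {h : Site 2} {r m : Fin 6} (k : Fin 6) : nbond h (r + k) ∈ EN h r m ↔ k ≤ m := by
  rw [mem_EN_iff]
  constructor
  · rintro ⟨k', hk', e⟩
    have := nbond_inj e
    rw [add_right_inj] at this
    rw [this]; exact hk'
  · exact fun hk => ⟨k, hk, rfl⟩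


/-- the new bonds are `nbond`s. [cite: KhristoforovSmirnov2021, §1.2 (arXiv v1 p. 2)] -/
theorem exists_eq_nbond_of_mem_EN {h : Site 2} {r m : Fin 6} {b : Sym2 (Site 2)} (hb : b ∈ EN h r m) : ∃ l : Fin 6, b = nbond h l := by
  obtain ⟨k, -, rfl⟩ := mem_EN_iff.1 hb
  exact ⟨r + k, rfl⟩

/-- `Fin 6` bookkeeping. [folklore] -/
private theorem fin_run₂ (k m : Fin 6) (hm : m.val ≤ 4) :
    (k < m → k + 1 ≤ m) ∧ m < 5 ∧ (m ≤ k → k ≠ 5 → m < k + 1) ∧ (1 ≤ k.val → (k + 5).val = k.val - 1 ∧ k + 5 + 1 = k) := by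
  revert hm; revert k m; decide

/-- `Fin 6` bookkeeping: the parity step of the whole outer path. [folklore] -/
private theorem fin_parity (k m : Fin 6) (hm : m.val ≤ 4) : ¬ (k + 1 ≤ m ↔ k ≤ m) ↔ (k = m ∨ k = 5) := by
  revert hm; revert k m; decide

/-- ★ **the side count of the whole outer path `EN` at the face `N_{r+k}` is odd exactly at the two END FACES `P = N_{r+5}` and `Q = N_{r+m}`.**
[cite: KhristoforovSmirnov2021, §1.2 (arXiv v1 p. 2: `IP(ξ)` is a union of disjoint paths)] -/
theorem odd_xiDeg_EN_iff {h : Site 2} {r m : Fin 6} (hm : m.val ≤ 4) (k : Fin 6) :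
    Odd (xiDeg (EN h r m) (leftFaceDir h (r + k))) ↔ k = m ∨ k = 5 := by
  rw [SlideData.odd_xiDeg_N_iff (fun b hb => exists_eq_nbond_of_mem_EN hb) (r + k), add_assoc, nbond_mem_EN_iff, nbond_mem_EN_iff]
  exact fin_parity k m hm

/-- ★ **the whole outer path joins `P = N_{r+5}` to every `N_{r+k}`, `k ≤ m`** (in particular to `Q = N_{r+m}`), inside its own side graph.
[cite: KhristoforovSmirnov2021, §1.2 (arXiv v1 p. 2)] -/
theorem EN_reachable {h : Site 2} {r m : Fin 6} (hm : m.val ≤ 4) {k : Fin 6} (hk : k ≤ m) :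
    (sideGraph (EN h r m)).Reachable (leftFaceDir h (r + 5)) (leftFaceDir h (r + k)) := by
  suffices H : ∀ n : ℕ, ∀ k : Fin 6, k.val = n → k ≤ m → (sideGraph (EN h r m)).Reachable (leftFaceDir h (r + 5)) (leftFaceDir h (r + k)) from
    H _ k rfl hk
  intro n
  induction n with
  | zero =>
    intro k hk0 _
    have e : k = 0 := Fin.ext hk0
    subst e
    have h51 : (5 : Fin 6) + 1 = 0 := by decide
    have h5 : (r + 5 : Fin 6) + 1 = r + 0 := by rw [add_assoc, h51]
    have hadj := SlideData.adj_N_succ (E := EN h r m) (r + 5) (by rw [h5, nbond_mem_EN_iff]; exact Fin.zero_le _)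
    rw [h5] at hadj
    exact hadj.reachable
  | succ n ih =>
    intro k hkn hkm
    obtain ⟨hv, hs'⟩ := (fin_run₂ k m hm).2.2.2 (by omega)
    have hlt : k + 5 < m := by rw [Fin.lt_def, hv]; rw [Fin.le_def] at hkm; omega
    have h1 := ih (k + 5) (by rw [hv]; omega) hlt.le
    have hadj := SlideData.adj_N_succ (E := EN h r m) (r + (k + 5)) (by rw [add_assoc, hs', nbond_mem_EN_iff]; exact hkm)
    rw [add_assoc, hs'] at hadj
    exact h1.trans hadj.reachable

/-- the faces of the new bonds: outer-path faces `N_{r+k}`, `k < m`, or the two end faces. [cite: KhristoforovSmirnov2021, §1.2 (arXiv v1 p. 2)] -/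
theorem EN_faces {h : Site 2} {r m : Fin 6} (hm : m.val ≤ 4) {b : Sym2 (Site 2)} (hb : b ∈ EN h r m) {F : HexVertex} (hF : Inc F b) :
    (∃ k : Fin 6, k < m ∧ F = leftFaceDir h (r + k)) ∨ F = leftFaceDir h (r + 5) ∨ F = leftFaceDir h (r + m) := by
  obtain ⟨k, hk, rfl⟩ := mem_EN_iff.1 hb
  rcases eq_N_or_of_inc (r + k) hF with rfl | rfl
  · rcases hk.lt_or_eq with hlt | rfl
    · exact Or.inl ⟨k, hlt, rfl⟩
    · exact Or.inr (Or.inr rfl)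
  · by_cases h0 : k = 0
    · subst h0; rw [add_zero]; exact Or.inr (Or.inl rfl)
    · have hk1 : 1 ≤ k.val := Nat.one_le_iff_ne_zero.2 fun e => h0 (Fin.ext e)
      refine Or.inl ⟨k + 5, ?_, by rw [add_assoc]⟩
      rw [Fin.lt_def, ((fin_run₂ k m hm).2.2.2 hk1).1]; rw [Fin.le_def] at hk; omega

/-! ### The marks of the domain with two more corners -/

/-- **THE TWO-MORE-MARKS DATA**: `E` is the small domain `D` (`k` corners) marked additionally at the two end faces `P = N_{r+5}`, `Q = N_{r+m}` of the outer path of the attached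
hexagon, inserted as the ADJACENT corners `j, j+1` (in either order); the old corners keep their faces, relabelled by `skip j`.
[cite: KhristoforovSmirnov2021, §1.2 (arXiv v1 pp. 2–3: disorders on the boundary); PearceRittenbergDeGierNienhuis2002, §2 (the sites `j, j+1` of the contraction)] -/
structure MarksData (D : TriMarkedDomain nm) (E : TriMarkedDomain (nm + 1 + 1)) (h : Site 2) (r m : Fin 6) (j : Fin (nm + 1)) : Prop where
  /-- same sites -/
  verts : E.verts = D.verts
  /-- the old corner faces, relabelled -/
  yc_skip : ∀ i, yc E (skip j i) = yc D i
  /-- the two new corner faces are the end faces of the outer path -/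
  yc_pair : (yc E (Fin.castSucc j) = leftFaceDir h (r + 5) ∧ yc E j.succ = leftFaceDir h (r + m)) ∨
    (yc E (Fin.castSucc j) = leftFaceDir h (r + m) ∧ yc E j.succ = leftFaceDir h (r + 5))

/-- every index of `Fin (k+2)` is `j`, `j+1` or a skipped one. [cite: PearceRittenbergDeGierNienhuis2002, §2 (link diagrams)] -/
theorem eq_castSucc_or_succ_or_skip (j : Fin (nm + 1)) (x : Fin (nm + 1 + 1)) : x = Fin.castSucc j ∨ x = j.succ ∨ ∃ i, x = skip j i := by
  by_cases h1 : x = Fin.castSucc j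
  · exact Or.inl h1
  by_cases h2 : x = j.succ
  · exact Or.inr (Or.inl h2)
  · exact Or.inr (Or.inr ⟨unskip j x h1 h2, (skip_unskip j x h1 h2).symm⟩)

namespace MarksData

variable {D : TriMarkedDomain nm} {E : TriMarkedDomain (nm + 1 + 1)} {h : Site 2} {r m : Fin 6} {j : Fin (nm + 1)} (M : MarksData D E h r m j)
include M

/-- same `H`-bonds. [cite: KhristoforovSmirnov2021, §1.2 (arXiv v1 p. 2)] -/
theorem hBonds_eq : hBonds E = hBonds D := hBonds_eq_of_verts_eq' (D := D) M.verts

/-- ★ **the corner faces of `E`**: those of `D`, or `P`, or `Q`. [cite: KhristoforovSmirnov2021, §1.2 (arXiv v1 pp. 2–3)] -/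
theorem mem_corners_iff {F : HexVertex} : F ∈ corners E ↔ F ∈ corners D ∨ F = leftFaceDir h (r + 5) ∨ F = leftFaceDir h (r + m) := by
  rw [mem_corners, mem_corners]
  constructor
  · rintro ⟨x, rfl⟩
    rcases eq_castSucc_or_succ_or_skip j x with rfl | rfl | ⟨i, rfl⟩
    · rcases M.yc_pair with ⟨e, -⟩ | ⟨e, -⟩
      · exact Or.inr (Or.inl e)
      · exact Or.inr (Or.inr e)
    · rcases M.yc_pair with ⟨-, e⟩ | ⟨-, e⟩
      · exact Or.inr (Or.inr e)
      · exact Or.inr (Or.inl e)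
    · exact Or.inl ⟨i, M.yc_skip i⟩
  · rintro (⟨i, rfl⟩ | rfl | rfl)
    · exact ⟨skip j i, (M.yc_skip i).symm⟩
    · rcases M.yc_pair with ⟨e, -⟩ | ⟨-, e⟩
      · exact ⟨_, e.symm⟩
      · exact ⟨_, e.symm⟩
    · rcases M.yc_pair with ⟨-, e⟩ | ⟨e, -⟩
      · exact ⟨_, e.symm⟩
      · exact ⟨_, e.symm⟩

/-- the end faces are not corner faces of `D`. [cite: KhristoforovSmirnov2021, §1.2 (arXiv v1 pp. 2–3)] -/
theorem endFace_not_corner {F : HexVertex} (hF : F = leftFaceDir h (r + 5) ∨ F = leftFaceDir h (r + m)) : F ∉ corners D := by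
  rw [mem_corners]
  rintro ⟨i, rfl⟩
  rw [← M.yc_skip i] at hF
  have key : ∀ x, yc E (skip j i) = yc E x → x = Fin.castSucc j ∨ x = j.succ → False := by
    rintro x e (rfl | rfl)
    · exact skip_ne_castSucc j i (yc_injective E e)
    · exact skip_ne_succ j i (yc_injective E e)
  rcases M.yc_pair with ⟨e1, e2⟩ | ⟨e1, e2⟩
  · rcases hF with e | e
    · exact key _ (e.trans e1.symm) (Or.inl rfl)
    · exact key _ (e.trans e2.symm) (Or.inr rfl)
  · rcases hF with e | e
    · exact key _ (e.trans e2.symm) (Or.inr rfl)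
    · exact key _ (e.trans e1.symm) (Or.inl rfl)

end MarksData

namespace AttachData

variable {D' D : TriMarkedDomain nm} {h : Site 2} {r m : Fin 6} (T : AttachData D' D h r m)
include T

/-! ### Plumbing (the ring facts of the attached hexagon, private copies) -/

/-- `h ∈ G'`. [cite: BollobasRiordan2006, Ch. 7 §7.2.2 p. 168] -/
private theorem h_mem₂ : h ∈ D'.verts := by rw [T.verts']; exact Finset.mem_insert_self _ _

/-- `H_G ⊆ H_{G'}`. [cite: KhristoforovSmirnov2021, §1.2 (arXiv v1 p. 2)] -/
private theorem hBonds_sub : hBonds D ⊆ hBonds D' := by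
  intro b hb
  obtain ⟨u, w, rfl, hu, hadj⟩ := exists_rep_of_mem_hBonds D hb
  refine mem_hBonds D' hadj (Or.inl ?_)
  rw [T.verts']; exact Finset.mem_insert_of_mem hu

/-- the new bonds are bonds of `H_{G'}`. [cite: KhristoforovSmirnov2021, §1.2 (arXiv v1 p. 2)] -/
private theorem nb_mem' (l : Fin 6) : nbond h l ∈ hBonds D' := mem_hBonds D' (triGraph_adj_add_triDir h _) (Or.inl T.h_mem₂)

/-- the new bonds are not bonds of `H_G`. [cite: KhristoforovSmirnov2021, §1.2 (arXiv v1 p. 2)] -/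
private theorem nb_notin {k : Fin 6} (hk : k ≤ m) : nbond h (r + k) ∉ hBonds D := by
  intro hb
  obtain ⟨u, w, he, hu, -⟩ := exists_rep_of_mem_hBonds D hb
  have hu' : u ∈ (nbond h (r + k) : Sym2 (Site 2)) := by rw [he]; exact Sym2.mem_mk_left u w
  rcases Sym2.mem_iff.1 hu' with rfl | rfl
  · exact T.not_mem hu
  · exact T.out k hk hu

/-- the outer-path faces `N_k`, `k < m`, do not touch `G`. [cite: BollobasRiordan2006, Ch. 7 §7.2.2 p. 168] -/
private theorem N_notin {k : Fin 6} (hk : k < m) : leftFaceDir h (r + k) ∉ triFacesTouching D.verts := by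
  intro ht
  obtain ⟨u, hu, huF⟩ := mem_triFacesTouching.1 ht
  rw [RemovableAt.hexFaceVertices_leftFaceDir, Finset.mem_insert, Finset.mem_insert, Finset.mem_singleton] at huF
  have hk1 := (fin_run₂ k m T.m_le).1 hk
  rcases huF with rfl | rfl | rfl
  · exact T.not_mem hu
  · exact T.out k hk.le hu
  · rw [add_assoc] at hu
    exact T.out (k + 1) hk1 hu

/-! ### The whole outer path as a two-root pendant attachment -/

/-- `EN` avoids `H_G`. [cite: KhristoforovSmirnov2021, §1.2 (arXiv v1 p. 2)] -/
theorem disjoint_EN {ξ : Finset (Sym2 (Site 2))} (hξ : ξ ⊆ hBonds D) : Disjoint ξ (EN h r m) := by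
  rw [Finset.disjoint_left]
  intro b hb hbE
  obtain ⟨k, hk, rfl⟩ := mem_EN_iff.1 hbE
  exact T.nb_notin hk (hξ hb)

/-- `EN ⊆ H_{G'}`. [cite: KhristoforovSmirnov2021, §1.2 (arXiv v1 p. 2)] -/
theorem EN_subset' : EN h r m ⊆ hBonds D' := by
  intro b hb
  obtain ⟨l, rfl⟩ := exists_eq_nbond_of_mem_EN hb
  exact T.nb_mem' l

/-- a face touching `G` is not an outer-path face. [cite: BollobasRiordan2006, Ch. 7 §7.2.2 p. 168] -/
theorem not_mem_outer_of_touching {F : HexVertex} (hF : F ∈ triFacesTouching D.verts) :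
    F ∉ ((Finset.univ : Finset (Fin 6)).filter fun k => k < m).image (fun k => leftFaceDir h (r + k)) := by
  intro h1
  obtain ⟨k, hk, rfl⟩ := Finset.mem_image.1 h1
  exact T.N_notin (Finset.mem_filter.1 hk).2 hF

/-- the two-root pendant hypotheses for `EN` over `H_G`: `S` = the outer-path faces, roots `P = N_{r+5}`, `Q = N_{r+m}`. [cite: KhristoforovSmirnov2021, §1.2 (arXiv v1 p. 2)] -/
theorem pendant₂ {ξ : Finset (Sym2 (Site 2))} (hξ : ξ ⊆ hBonds D) :
    (∀ F ∈ ((Finset.univ : Finset (Fin 6)).filter fun k => k < m).image (fun k => leftFaceDir h (r + k)), ∀ l : Fin 3,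
        side F l ∈ ξ ∪ EN h r m → side F l ∈ EN h r m) ∧
    (∀ F, F ∉ ((Finset.univ : Finset (Fin 6)).filter fun k => k < m).image (fun k => leftFaceDir h (r + k)) → F ≠ leftFaceDir h (r + 5) →
      F ≠ leftFaceDir h (r + m) → ∀ l : Fin 3, side F l ∉ EN h r m) := by
  constructor
  · intro F hF l hl
    obtain ⟨k, hk, rfl⟩ := Finset.mem_image.1 hF
    have hk' : k < m := (Finset.mem_filter.1 hk).2
    rcases Finset.mem_union.1 hl with h1 | h1
    · exact absurd (mem_touching_of_side_mem D (hξ h1)) (T.N_notin hk')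
    · exact h1
  · intro F hF hP hQ l hl
    rcases EN_faces T.m_le hl (inc_side F l) with ⟨k, hk, rfl⟩ | e | e
    · exact hF (Finset.mem_image.2 ⟨k, Finset.mem_filter.2 ⟨Finset.mem_univ _, hk⟩, rfl⟩)
    · exact hP e
    · exact hQ e

/-- ★★ **LINKS AFTER ATTACHING THE WHOLE OUTER PATH**: for `ξ ⊆ H_G` and faces `X, Y` touching `G`, `X ~ Y` in `ξ ∪ EN` iff `X ~ Y` in `ξ`, or `X ~ P` and `Q ~ Y`, or `X ~ Q` and
`P ~ Y` (the path identifies its two end faces). [cite: KhristoforovSmirnov2021, §1.2 (arXiv v1 p. 2: `IP(ξ)` is a union of disjoint paths); PearceRittenbergDeGierNienhuis2002, §2] -/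
theorem reachable_union_EN_iff {ξ : Finset (Sym2 (Site 2))} (hξ : ξ ⊆ hBonds D) {X Y : HexVertex} (hX : X ∈ triFacesTouching D.verts)
    (hY : Y ∈ triFacesTouching D.verts) :
    (sideGraph (ξ ∪ EN h r m)).Reachable X Y ↔ (sideGraph ξ).Reachable X Y ∨
      ((sideGraph ξ).Reachable X (leftFaceDir h (r + 5)) ∧ (sideGraph ξ).Reachable (leftFaceDir h (r + m)) Y) ∨
      ((sideGraph ξ).Reachable X (leftFaceDir h (r + m)) ∧ (sideGraph ξ).Reachable (leftFaceDir h (r + 5)) Y) :=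
  reachable_union_pendant₂_iff (T.pendant₂ hξ).1 (T.pendant₂ hξ).2 (T.disjoint_EN hξ) (EN_reachable T.m_le le_rfl) (T.not_mem_outer_of_touching hX)
    (T.not_mem_outer_of_touching hY)

/-- ★ **the side count of `EN` at any face is odd exactly at the two end faces.** [cite: KhristoforovSmirnov2021, §1.2 (arXiv v1 p. 2)] -/
theorem odd_xiDeg_EN_iff_face (F : HexVertex) : Odd (xiDeg (EN h r m) F) ↔ F = leftFaceDir h (r + 5) ∨ F = leftFaceDir h (r + m) := by
  by_cases hh : h ∈ hexFaceVertices F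
  · obtain ⟨k, rfl⟩ := exists_eq_N_of_mem r hh
    rw [odd_xiDeg_EN_iff T.m_le k]
    constructor
    · rintro (rfl | rfl)
      · exact Or.inr rfl
      · exact Or.inl rfl
    · rintro (e | e)
      · exact Or.inr (N_inj e)
      · exact Or.inl (N_inj e)
  · have h0 : xiDeg (EN h r m) F = 0 := by
      rw [l1_xiDeg_eq, Finset.card_eq_zero, Finset.filter_eq_empty_iff]
      intro l _ hl
      obtain ⟨l', e⟩ := exists_eq_nbond_of_mem_EN hl
      exact side_ne_nbond_of_not_mem hh l _ e
    rw [h0]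
    constructor
    · intro h1; exact absurd h1 (by decide)
    · rintro (e | e)
      · rw [e, RemovableAt.hexFaceVertices_leftFaceDir] at hh; exact absurd (Finset.mem_insert_self _ _) hh
      · rw [e, RemovableAt.hexFaceVertices_leftFaceDir] at hh; exact absurd (Finset.mem_insert_self _ _) hh


/-! ### Parity profiles and the spaces: `ξ ∪ EN ∈ W^{D'}_z(s) ↔ ξ ∈ W^{E}_z(s)` -/

section WithMarks

variable {E : TriMarkedDomain (nm + 1 + 1)} {j : Fin (nm + 1)} (M : MarksData D E h r m j)
include M

omit T M in
/-- propositional bookkeeping of the parity profile at a face touching `G`. [cite: KhristoforovSmirnov2021, §1.2 (arXiv v1 pp. 2–3); lane plumbing] -/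
private theorem prop_parity (O R C X : Prop) (hRC : R → ¬ C) : ((O ↔ ¬ R) ↔ (C ∧ ¬ X ∨ X ∧ ¬ C)) ↔ (O ↔ ((C ∨ R) ∧ ¬ X ∨ X ∧ ¬ (C ∨ R))) := by
  tauto

/-- ★★ **THE PARITY PROFILES CORRESPOND**: for `ξ ⊆ H_G` and a face `s` touching `G`, `ξ ∪ EN` has odd faces «corners of `D'` XOR `s`» over the faces touching `G'` iff `ξ` has odd
faces «corners of `E` XOR `s`» over the faces touching `G` (the path flips the parity exactly at its two end faces, the two extra corners of `E`).
[cite: KhristoforovSmirnov2021, §1.2 (arXiv v1 pp. 2–3: loop configurations with prescribed disorders)] -/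
theorem parityIs_union_EN_iff {ξ : Finset (Sym2 (Site 2))} (hξ : ξ ⊆ hBonds D) {s : HexVertex} (hs : s ∈ triFacesTouching D.verts) :
    ParityIs D' (ξ ∪ EN h r m) (symmDiff (corners D') {s}) ↔ ParityIs E ξ (symmDiff (corners E) {s}) := by
  have hdisj := T.disjoint_EN hξ
  have key : ∀ F ∈ triFacesTouching D.verts,
      ((Odd (xiDeg (ξ ∪ EN h r m) F) ↔ F ∈ symmDiff (corners D') {s}) ↔ (Odd (xiDeg ξ F) ↔ F ∈ symmDiff (corners E) {s})) := by
    intro F _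
    rw [xiDeg_union_of_disjoint hdisj, Nat.odd_add, ← Nat.not_odd_iff_even, T.odd_xiDeg_EN_iff_face F, Finset.mem_symmDiff, Finset.mem_symmDiff,
      Finset.mem_singleton, T.corners_eq, M.mem_corners_iff]
    exact prop_parity _ _ _ _ fun hR hC => M.endFace_not_corner hR hC
  unfold ParityIs
  rw [M.verts]
  constructor
  · intro hP F hF
    exact (key F hF).1 (hP F (T.mem_touching'_iff.2 (Or.inl hF)))
  · intro hP F hF
    rcases T.mem_touching'_iff.1 hF with hF₁ | ⟨k, hk, rfl⟩
    · exact (key F hF₁).2 (hP F hF₁)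
    · -- an outer-path face: no `ξ`-side, even `EN`-count, not a corner, not `s`
      have h0 : xiDeg ξ (leftFaceDir h (r + k)) = 0 := by
        rw [l1_xiDeg_eq, Finset.card_eq_zero, Finset.filter_eq_empty_iff]
        intro l _ hl
        exact T.N_notin hk (mem_touching_of_side_mem D (hξ hl))
      rw [xiDeg_union_of_disjoint hdisj, h0, zero_add, odd_xiDeg_EN_iff T.m_le k, Finset.mem_symmDiff, Finset.mem_singleton]
      have hks : leftFaceDir h (r + k) ≠ s := fun e => T.N_notin hk (e ▸ hs)
      have hkc : leftFaceDir h (r + k) ∉ corners D' := T.N_not_corner' hk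
      have hkm : k ≠ m := hk.ne
      have hk5 : k ≠ 5 := fun e => by
        have h5 := (fin_run₂ k m T.m_le).2.1
        rw [e] at hk
        exact absurd (hk.trans h5) (lt_irrefl _)
      simp only [hks, hkc, hkm, hk5, false_and, or_self]

/-- ★★ **ADDING THE WHOLE OUTER PATH IS A BIJECTION ONTO THE CONFIGURATIONS OF `D'` CONTAINING IT**: for `ξ ⊆ H_G`, `ξ ∪ EN ∈ W^{D'}_z(s)` iff `ξ ∈ W^{E}_z(s)` (`z = side v i` an
`H_G`-edge, `s` touching `G`). [cite: KhristoforovSmirnov2021, §1.2 (arXiv v1 pp. 2–3); §2 Definition 3 (p. 4)] -/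
theorem union_EN_mem_TXb_iff {ξ : Finset (Sym2 (Site 2))} (hξ : ξ ⊆ hBonds D) {v : HexVertex} {i : Fin 3} (hz : side v i ∈ hBonds D) {s : HexVertex}
    (hs : s ∈ triFacesTouching D.verts) : ξ ∪ EN h r m ∈ TXb D' v i s ↔ ξ ∈ TXb E v i s := by
  rw [mem_TXb_iff, mem_TXb_iff, T.parityIs_union_EN_iff M hξ hs, M.hBonds_eq]
  refine and_congr ⟨fun h1 b hb => ?_, fun h1 b hb => ?_⟩ Iff.rfl
  · exact Finset.mem_erase.2 ⟨(Finset.mem_erase.1 (h1 (Finset.mem_union_left _ hb))).1, hξ hb⟩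
  · rcases Finset.mem_union.1 hb with hb | hb
    · exact Finset.mem_erase.2 ⟨(Finset.mem_erase.1 (h1 hb)).1, T.hBonds_sub (hξ hb)⟩
    · refine Finset.mem_erase.2 ⟨?_, T.EN_subset' hb⟩
      rintro rfl
      obtain ⟨k, hk, e⟩ := mem_EN_iff.1 hb
      exact T.nb_notin hk (e ▸ hz)

omit M in
/-- **restriction**: a configuration of `D'` (at an `H_G`-edge, odd face touching `G`) containing the first new bond is `ξ ∪ EN` with `ξ ⊆ H_G` its `H_G`-part (the all-or-nothing walk).
[cite: KhristoforovSmirnov2021, §1.2 (arXiv v1 p. 2)] -/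
theorem eq_filter_union_EN {v : HexVertex} {i : Fin 3} {s : HexVertex} (hs : s ∈ triFacesTouching D.verts) {ζ : Finset (Sym2 (Site 2))} (hζ : ζ ∈ TXb D' v i s)
    (h0 : nbond h r ∈ ζ) : ζ = ζ.filter (· ∈ hBonds D) ∪ EN h r m ∧ ζ.filter (· ∈ hBonds D) ⊆ hBonds D := by
  classical
  refine ⟨?_, fun b hb => (Finset.mem_filter.1 hb).2⟩
  have hsub : ζ ⊆ hBonds D' := fun b hb => (Finset.mem_erase.1 (((mem_TXb_iff (D := D') v i s ζ).1 hζ).1 hb)).2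
  ext b
  rw [Finset.mem_union, Finset.mem_filter]
  constructor
  · intro hb
    by_cases hb1 : b ∈ hBonds D
    · exact Or.inl ⟨hb, hb1⟩
    · -- a bond of `H_{G'}` off `H_G` is a new bond
      obtain ⟨u, w, rfl, hu, hadj⟩ := exists_rep_of_mem_hBonds D' (hsub hb)
      rw [T.verts', Finset.mem_insert] at hu
      rcases hu with rfl | hu
      · obtain ⟨l, rfl⟩ := (triGraph_adj_iff_triDir u w).1 hadj
        obtain ⟨k, rfl⟩ : ∃ k : Fin 6, l = r + k := ⟨l - r, by rw [add_sub_cancel]⟩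
        by_cases hk : k ≤ m
        · exact Or.inr ((nbond_mem_EN_iff k).2 hk)
        · exfalso; apply hb1
          have hb₁ := mem_hBonds D hadj.symm (Or.inl (T.inside k (not_le.1 hk)))
          rwa [Sym2.eq_swap] at hb₁
      · exact absurd (mem_hBonds D hadj (Or.inl hu)) hb1
  · rintro (⟨hb, -⟩ | hb)
    · exact hb
    · obtain ⟨k, hk, rfl⟩ := mem_EN_iff.1 hb
      exact (T.nbond_mem_iff_of_mem_TXb hs hζ hk).2 h0

omit M in
/-- the `H_G`-part of `ξ ∪ EN` is `ξ`. [cite: KhristoforovSmirnov2021, §1.2 (arXiv v1 p. 2)] -/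
theorem filter_union_EN_eq {ξ : Finset (Sym2 (Site 2))} (hξ : ξ ⊆ hBonds D) : (ξ ∪ EN h r m).filter (· ∈ hBonds D) = ξ := by
  classical
  ext b
  rw [Finset.mem_filter, Finset.mem_union]
  constructor
  · rintro ⟨hb | hb, hb₁⟩
    · exact hb
    · obtain ⟨k, hk, rfl⟩ := mem_EN_iff.1 hb
      exact absurd hb₁ (T.nb_notin hk)
  · exact fun hb => ⟨Or.inl hb, hξ hb⟩

/-! ### The pattern after attaching the path is the CONTRACTION of the pattern with the two extra marks -/

/-- links after attaching the path, the end faces named by their corner indices `j, j+1` of `E`. [cite: KhristoforovSmirnov2021, §1.2 (arXiv v1 p. 2)] -/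
theorem reachable_union_EN_iff' {ξ : Finset (Sym2 (Site 2))} (hξ : ξ ⊆ hBonds D) {X Y : HexVertex} (hX : X ∈ triFacesTouching D.verts)
    (hY : Y ∈ triFacesTouching D.verts) :
    (sideGraph (ξ ∪ EN h r m)).Reachable X Y ↔ (sideGraph ξ).Reachable X Y ∨
      ((sideGraph ξ).Reachable X (yc E (Fin.castSucc j)) ∧ (sideGraph ξ).Reachable (yc E j.succ) Y) ∨
      ((sideGraph ξ).Reachable X (yc E j.succ) ∧ (sideGraph ξ).Reachable (yc E (Fin.castSucc j)) Y) := by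
  rw [T.reachable_union_EN_iff hξ hX hY]
  rcases M.yc_pair with ⟨e1, e2⟩ | ⟨e1, e2⟩
  · rw [e1, e2]
  · rw [e1, e2]; exact or_congr_right or_comm

omit T M in
/-- two corner faces are linked iff the pair is in the link relation. [cite: KhristoforovSmirnov2021, §1.2 (arXiv v1 p. 2: the link pattern)] -/
theorem reachable_yc_iff {ξ : Finset (Sym2 (Site 2))} {a b : Fin (nm + 1 + 1)} (hab : a ≠ b) :
    (sideGraph ξ).Reachable (yc E a) (yc E b) ↔ (a, b) ∈ linkRel E ξ := by
  rw [mem_linkRel, xiLinked_iff_reachable]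
  exact ⟨fun h1 => ⟨hab, h1⟩, fun h1 => h1.2⟩

omit T M in
/-- in a configuration of the class `[z ↔ u_p]` the odd face is linked to the corner face `y_x` iff `x = p`.
[cite: KhristoforovSmirnov2021, §2 (arXiv v1 pp. 3–4: every configuration has exactly one link pattern) and Definition 3 (p. 4)] -/
theorem reachable_s_yc_iff {v : HexVertex} (hv : AllSides E v) {i : Fin 3} {s : HexVertex} (hs : s ∈ ({v, oppFace v i} : Finset HexVertex))
    {ξ : Finset (Sym2 (Site 2))} (hξ : ξ ∈ TXb E v i s) {p : Fin (nm + 1 + 1)} (hp : InClassX E (faceVertex v (i + 1)) (faceVertex v (i + 2)) s p ξ)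
    (x : Fin (nm + 1 + 1)) : (sideGraph ξ).Reachable s (yc E x) ↔ x = p := by
  constructor
  · intro h1
    have hx : InClassX E (faceVertex v (i + 1)) (faceVertex v (i + 2)) s x ξ := (hbK_inClassX_iff _ _ _ _ _).2 ⟨((hbK_inClassX_iff _ _ _ _ _).1 hp).1, h1⟩
    exact (existsUnique_inClassX E hv i hs hξ).unique hx hp
  · rintro rfl
    exact ((hbK_inClassX_iff _ _ _ _ _).1 hp).2

/-- ★★★ **THE PARTNER AFTER ATTACHING THE PATH IS THE PARTNER OF THE CONTRACTED PATTERN**: if `ξ ∈ W^{E}_z(s)` has the outermost pattern `q` (partner `q.1.1.1`, link relation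
`q.1.1.2`) then `ξ ∪ EN` lies in the class `[z ↔ u_c]` of `D'` iff `c` is the partner of `q.contract j`.
[cite: KhristoforovSmirnov2021, §1.2 (arXiv v1 p. 2), §2 Definition 3 (p. 4); PearceRittenbergDeGierNienhuis2002, §2 (monoid: the contraction joins the two strands)] -/
theorem inClassX_union_EN_iff {v : HexVertex} (hv : AllSides E v) {i : Fin 3} (hz : side v i ∈ hBonds D) {s : HexVertex}
    (hs₂ : s ∈ ({v, oppFace v i} : Finset HexVertex)) (hs : s ∈ triFacesTouching D.verts) {ξ : Finset (Sym2 (Site 2))} (hξ : ξ ∈ TXb E v i s)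
    (q : Pat₀ (nm + 1 + 1)) (hcl : InClassX E (faceVertex v (i + 1)) (faceVertex v (i + 2)) s q.1.1.1 ξ) (hL : linkRel E ξ = q.1.1.2) (c : Fin nm) :
    InClassX D' (faceVertex v (i + 1)) (faceVertex v (i + 2)) s c (ξ ∪ EN h r m) ↔ (q.contract j).1.1.1 = c := by
  have hξD : ξ ⊆ hBonds D := fun b hb => by
    have := ((mem_TXb_iff (D := E) v i s ξ).1 hξ).1 hb
    rw [M.hBonds_eq] at this
    exact (Finset.mem_erase.1 this).2
  have hP := q.1.2
  rw [hbK_inClassX_iff, T.yc_eq c, ← M.yc_skip c, Pat₀.contract_partner_eq_iff]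
  have hmem' : ξ ∪ EN h r m ∈ TXb D' v i s := (T.union_EN_mem_TXb_iff M hξD hz hs).2 hξ
  rw [and_iff_right (show ξ ∪ EN h r m ∈ loopSpaceX D' (faceVertex v (i + 1)) (faceVertex v (i + 2)) s from hmem'),
    T.reachable_union_EN_iff' M hξD hs (by rw [M.yc_skip]; exact yc_mem_touching D c),
    reachable_s_yc_iff hv hs₂ hξ hcl, reachable_s_yc_iff hv hs₂ hξ hcl, reachable_s_yc_iff hv hs₂ hξ hcl,
    reachable_yc_iff (skip_ne_succ j c).symm, reachable_yc_iff (skip_ne_castSucc j c).symm, hL]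
  constructor
  · rintro (e | ⟨e, h2⟩ | ⟨e, h2⟩)
    · exact Or.inl e
    · exact Or.inr (Or.inr ⟨hP.symm _ _ h2, e.symm⟩)
    · exact Or.inr (Or.inl ⟨hP.symm _ _ h2, e.symm⟩)
  · rintro (e | ⟨h2, e⟩ | ⟨h2, e⟩)
    · exact Or.inl e
    · exact Or.inr (Or.inr ⟨e.symm, hP.symm _ _ h2⟩)
    · exact Or.inr (Or.inl ⟨e.symm, hP.symm _ _ h2⟩)

/-- ★★★ **THE LINK RELATION AFTER ATTACHING THE PATH IS THE LINK RELATION OF THE CONTRACTED PATTERN.**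
[cite: KhristoforovSmirnov2021, §1.2 (arXiv v1 p. 2: the link pattern `IP(ξ)`); PearceRittenbergDeGierNienhuis2002, §2 (monoid)] -/
theorem linkRel_union_EN_eq {v : HexVertex} {i : Fin 3} {s : HexVertex} {ξ : Finset (Sym2 (Site 2))} (hξ : ξ ∈ TXb E v i s) (q : Pat₀ (nm + 1 + 1))
    (hL : linkRel E ξ = q.1.1.2) : linkRel D' (ξ ∪ EN h r m) = (q.contract j).1.1.2 := by
  have hξD : ξ ⊆ hBonds D := fun b hb => by
    have := ((mem_TXb_iff (D := E) v i s ξ).1 hξ).1 hb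
    rw [M.hBonds_eq] at this
    exact (Finset.mem_erase.1 this).2
  have hP := q.1.2
  have hjs : Fin.castSucc j ≠ j.succ := ne_of_lt Fin.castSucc_lt_succ
  ext ⟨a, b⟩
  rw [mem_linkRel, xiLinked_iff_reachable, T.yc_eq a, T.yc_eq b, ← M.yc_skip a, ← M.yc_skip b, Pat₀.mem_contract_iff,
    T.reachable_union_EN_iff' M hξD (by rw [M.yc_skip]; exact yc_mem_touching D a) (by rw [M.yc_skip]; exact yc_mem_touching D b),
    reachable_yc_iff (skip_ne_castSucc j a), reachable_yc_iff (skip_ne_succ j b).symm, reachable_yc_iff (skip_ne_succ j a),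
    reachable_yc_iff (skip_ne_castSucc j b).symm, hL]
  by_cases hab : a = b
  · subst hab
    simp only [ne_eq, not_true_eq_false, false_and, false_iff]
    rintro (h1 | ⟨h1, h2⟩ | ⟨h1, h2⟩)
    · exact hP.irrefl _ h1
    · exact hjs (hP.partner_eq h1 (hP.symm _ _ h2))
    · exact hjs (hP.partner_eq (hP.symm _ _ h2) h1)
  · rw [reachable_yc_iff ((skip_injective j).ne hab), hL]
    simp only [ne_eq, hab, not_false_eq_true, true_and]

end WithMarks

end AttachData

/-! ### Every configuration at a boundary point of the home arc realises exactly one pattern, and it is outermost -/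

/-- ★ **at a boundary mid-edge of the home arc every configuration realises an OUTERMOST pattern** (the class is unique, the link relation is a pattern, and the arc law
kills the non-outermost ones). [cite: KhristoforovSmirnov2021, §1.2 (arXiv v1 p. 2) and §2 eq. (4) (p. 5)] -/
theorem exists_pat₀_of_mem_TXb {n : ℕ} {D : TriMarkedDomain (n + 1)} (z : ArcPoint D (Fin.last n)) {s : HexVertex}
    (hs : s ∈ ({z.v, oppFace z.v z.i} : Finset HexVertex)) {ξ : Finset (Sym2 (Site 2))} (hξ : ξ ∈ TXb D z.v z.i s) :
    ∃ q : Pat₀ (n + 1), InClassX D (faceVertex z.v (z.i + 1)) (faceVertex z.v (z.i + 2)) s q.1.1.1 ξ ∧ linkRel D ξ = q.1.1.2 := by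
  classical
  obtain ⟨p, hp, -⟩ := existsUnique_inClassX D z.allSides z.i hs hξ
  have hsc : s ∉ corners D := by
    rw [Finset.mem_insert, Finset.mem_singleton] at hs
    rcases hs with rfl | rfl
    · exact z.not_corner
    · exact z.opp_not_corner
  have hpat : IsPattern p (linkRel D ξ) := isPattern_linkRel z.allSides hs hsc hξ hp
  let P : Pat (n + 1) := ⟨(p, linkRel D ξ), hpat⟩
  have hdepth : P.pdepth = 0 := by
    by_contra hd
    have hout : P ∉ outAt (Fin.last n) := fun h1 => hd ((mem_outAt_last_iff P).1 h1)
    have h0 := patternCount_eq_zero_of_not_mem_outAt z.allSides z.not_corner z.opp_not_corner z.side_eq z.mem_stretch hout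
    unfold patternCount at h0
    rw [Finset.mem_insert, Finset.mem_singleton] at hs
    rcases hs with hs | hs
    · have hmem : ξ ∈ (TXb D z.v z.i z.v).filter fun ξ => InClassX D (faceVertex z.v (z.i + 1)) (faceVertex z.v (z.i + 2)) z.v P.1.1 ξ ∧ linkRel D ξ = P.1.2 :=
        Finset.mem_filter.2 ⟨hs ▸ hξ, hs ▸ hp, rfl⟩
      have := Finset.card_pos.2 ⟨ξ, hmem⟩
      omega
    · have hmem : ξ ∈ (TXb D z.v z.i (oppFace z.v z.i)).filter fun ξ =>
          InClassX D (faceVertex z.v (z.i + 1)) (faceVertex z.v (z.i + 2)) (oppFace z.v z.i) P.1.1 ξ ∧ linkRel D ξ = P.1.2 :=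
        Finset.mem_filter.2 ⟨hs ▸ hξ, hs ▸ hp, rfl⟩
      have := Finset.card_pos.2 ⟨ξ, hmem⟩
      omega
  exact ⟨⟨P, hdepth⟩, hp, rfl⟩

/-- the outermost pattern realised by a configuration is unique. [cite: KhristoforovSmirnov2021, §2 (arXiv v1 pp. 3–4: every configuration has exactly one link pattern)] -/
theorem pat₀_unique_of_mem_TXb {n : ℕ} {D : TriMarkedDomain (n + 1)} {v : HexVertex} (hv : AllSides D v) {i : Fin 3} {s : HexVertex}
    (hs : s ∈ ({v, oppFace v i} : Finset HexVertex)) {ξ : Finset (Sym2 (Site 2))} (hξ : ξ ∈ TXb D v i s) {q q' : Pat₀ (n + 1)}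
    (hq : InClassX D (faceVertex v (i + 1)) (faceVertex v (i + 2)) s q.1.1.1 ξ ∧ linkRel D ξ = q.1.1.2)
    (hq' : InClassX D (faceVertex v (i + 1)) (faceVertex v (i + 2)) s q'.1.1.1 ξ ∧ linkRel D ξ = q'.1.1.2) : q = q' := by
  have h1 : q.1.1.1 = q'.1.1.1 := (existsUnique_inClassX D hv i hs hξ).unique hq.1 hq'.1
  have h2 : q.1.1.2 = q'.1.1.2 := hq.2.symm.trans hq'.2
  exact Subtype.ext (Subtype.ext (Prod.ext h1 h2))


/-! ### The present part of the law is the contraction of the law with two more marks -/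

namespace AttachData

variable {n : ℕ} {D' D : TriMarkedDomain (n + 1)} {h : Site 2} {r m : Fin 6} (T : AttachData D' D h r m)
  {E : TriMarkedDomain (n + 1 + 1 + 1)} {j : Fin (n + 1 + 1)} (M : MarksData D E h r m j)
include T M

open Classical in
/-- ★★★ **THE PRESENT CONFIGURATIONS ARE COUNTED BY THE CONTRACTION FIBRE**: at a boundary mid-edge `z` of the home arc of `E` (an `H_G`-edge), odd face `s`, the configurations of
`D'` containing the outer path with outermost pattern `p` are equinumerous — by deleting the path — with the configurations of `E` whose outermost pattern contracts to `p`
at `j, j+1`. [cite: KhristoforovSmirnov2021, §1.2 (arXiv v1 p. 2: the law of the link pattern), §2 Definition 3 (p. 4); PearceRittenbergDeGierNienhuis2002, §2 (monoid: contraction)] -/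
theorem card_present_eq_sum (zE : ArcPoint E (Fin.last (n + 1 + 1))) (hz : side zE.v zE.i ∈ hBonds D) {s : HexVertex}
    (hs₂ : s ∈ ({zE.v, oppFace zE.v zE.i} : Finset HexVertex)) (hs : s ∈ triFacesTouching D.verts) (p : Pat₀ (n + 1)) :
    #((TXb D' zE.v zE.i s).filter fun ζ =>
        (InClassX D' (faceVertex zE.v (zE.i + 1)) (faceVertex zE.v (zE.i + 2)) s p.1.1.1 ζ ∧ linkRel D' ζ = p.1.1.2) ∧ nbond h r ∈ ζ) =
      ∑ q ∈ Finset.univ.filter (fun q : Pat₀ (n + 1 + 1 + 1) => q.contract j = p),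
        #((TXb E zE.v zE.i s).filter fun ξ => InClassX E (faceVertex zE.v (zE.i + 1)) (faceVertex zE.v (zE.i + 2)) s q.1.1.1 ξ ∧ linkRel E ξ = q.1.1.2) := by
  -- the classes of `E` are pairwise disjoint
  have hdisj : ∀ q ∈ Finset.univ.filter (fun q : Pat₀ (n + 1 + 1 + 1) => q.contract j = p),
      ∀ q' ∈ Finset.univ.filter (fun q : Pat₀ (n + 1 + 1 + 1) => q.contract j = p), q ≠ q' →
        Disjoint ((TXb E zE.v zE.i s).filter fun ξ => InClassX E (faceVertex zE.v (zE.i + 1)) (faceVertex zE.v (zE.i + 2)) s q.1.1.1 ξ ∧ linkRel E ξ = q.1.1.2)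
          ((TXb E zE.v zE.i s).filter fun ξ => InClassX E (faceVertex zE.v (zE.i + 1)) (faceVertex zE.v (zE.i + 2)) s q'.1.1.1 ξ ∧ linkRel E ξ = q'.1.1.2) := by
    intro q _ q' _ hne
    rw [Finset.disjoint_left]
    intro ξ h1 h2
    rw [Finset.mem_filter] at h1 h2
    exact hne (pat₀_unique_of_mem_TXb zE.allSides hs₂ h1.1 h1.2 h2.2)
  rw [← Finset.card_biUnion hdisj]
  refine Finset.card_bij (fun ζ _ => ζ.filter (· ∈ hBonds D)) (fun ζ hζ => ?_) (fun ζ₁ h₁ ζ₂ h₂ e => ?_) (fun ξ hξ => ?_)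
  · -- deleting the path lands in a class of the fibre
    rw [Finset.mem_filter] at hζ
    obtain ⟨hmem, ⟨hcl, hL⟩, h0⟩ := hζ
    obtain ⟨e, hξD⟩ := T.eq_filter_union_EN hs hmem h0
    rw [e] at hmem hcl hL
    have hξE : ζ.filter (· ∈ hBonds D) ∈ TXb E zE.v zE.i s := (T.union_EN_mem_TXb_iff M hξD hz hs).1 hmem
    obtain ⟨q, hq, hqL⟩ := exists_pat₀_of_mem_TXb zE hs₂ hξE
    have hpart : (q.contract j).1.1.1 = p.1.1.1 := (T.inClassX_union_EN_iff M zE.allSides hz hs₂ hs hξE q hq hqL p.1.1.1).1 hcl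
    have hrel : (q.contract j).1.1.2 = p.1.1.2 := (T.linkRel_union_EN_eq M hξE q hqL).symm.trans hL
    have hqp : q.contract j = p := Subtype.ext (Subtype.ext (Prod.ext hpart hrel))
    exact Finset.mem_biUnion.2 ⟨q, Finset.mem_filter.2 ⟨Finset.mem_univ _, hqp⟩, Finset.mem_filter.2 ⟨hξE, hq, hqL⟩⟩
  · -- injective
    rw [Finset.mem_filter] at h₁ h₂
    rw [(T.eq_filter_union_EN hs h₁.1 h₁.2.2).1, (T.eq_filter_union_EN hs h₂.1 h₂.2.2).1, e]
  · -- surjective: add the path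
    obtain ⟨q, hq, hξq⟩ := Finset.mem_biUnion.1 hξ
    rw [Finset.mem_filter] at hq hξq
    obtain ⟨hξE, hcl, hL⟩ := hξq
    have hqp : q.contract j = p := hq.2
    have hξD : ξ ⊆ hBonds D := fun b hb => by
      have := ((mem_TXb_iff (D := E) zE.v zE.i s ξ).1 hξE).1 hb
      rw [M.hBonds_eq] at this
      exact (Finset.mem_erase.1 this).2
    refine ⟨ξ ∪ EN h r m, ?_, T.filter_union_EN_eq hξD⟩
    rw [Finset.mem_filter]
    refine ⟨(T.union_EN_mem_TXb_iff M hξD hz hs).2 hξE, ⟨?_, ?_⟩, ?_⟩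
    · exact (T.inClassX_union_EN_iff M zE.allSides hz hs₂ hs hξE q hcl hL p.1.1.1).2 (by rw [hqp])
    · rw [T.linkRel_union_EN_eq M hξE q hL, hqp]
    · refine Finset.mem_union_right _ ?_
      have h0 := (nbond_mem_EN_iff (h := h) (r := r) (m := m) 0).2 (Fin.zero_le _)
      rwa [add_zero] at h0

/-- ★★★ **`N^{D', present}_p(z) = Σ_{q : q.contract j = p} N^{E}_q(z)`** for every outermost pattern `p`, at every boundary mid-edge `z` of the home arc of `E`.
[cite: KhristoforovSmirnov2021, §1.2 (arXiv v1 p. 2: the law of the link pattern); PearceRittenbergDeGierNienhuis2002, §2 (monoid: contraction)] -/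
theorem presentCount_eq_sum (zE : ArcPoint E (Fin.last (n + 1 + 1))) (hz : side zE.v zE.i ∈ hBonds D) (p : Pat₀ (n + 1)) :
    presentCount D' h r zE.v zE.i p.1 = ∑ q ∈ Finset.univ.filter (fun q : Pat₀ (n + 1 + 1 + 1) => q.contract j = p), patternCount E zE.v zE.i q.1 := by
  have hv : zE.v ∈ triFacesTouching D.verts := mem_touching_of_side_mem D hz
  have ho : oppFace zE.v zE.i ∈ triFacesTouching D.verts :=
    mem_touching_of_side_mem D (j := oppIdx zE.v zE.i) (by rw [side_oppFace_oppIdx]; exact hz)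
  unfold presentCount patternCount
  rw [T.card_present_eq_sum M zE hz (by simp) hv p, T.card_present_eq_sum M zE hz (by simp) ho p, ← Finset.sum_add_distrib]

/-- ★★★★ **F2 — ATTACHING A WHOLE OUTER PATH: `lawLP z' = lawLP z + contractL j (lawLP z_E)`.** For `D' = (Ω ∪ h; M̂)` obtained from `D = (Ω; M̂)` by attaching one hexagon with no
mark on it (`AttachData`), and `E = (Ω; M̂ + P + Q)` the small domain marked additionally at the two end faces of the outer path as the adjacent corners `j, j+1` (`MarksData`),
the boundary link-pattern law of `D'` at a mid-edge `z` of the common home arc is the law of `D` plus the Temperley–Lieb CONTRACTION at `j` of the law of `E`.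
[cite: KhristoforovSmirnov2021, §1.2 (arXiv v1 p. 2: the law of the link pattern); PearceRittenbergDeGierNienhuis2002, §2 (monoid: `e_j` = cap ∘ contraction at loop weight `1`)] -/
theorem lawLP_eq_add_contractL_lawLP (z' : ArcPoint D' (Fin.last n)) (z : ArcPoint D (Fin.last n)) (zE : ArcPoint E (Fin.last (n + 1 + 1)))
    (hv' : z'.v = z.v) (hi' : z'.i = z.i) (hvE : zE.v = z.v) (hiE : zE.i = z.i) :
    lawLP z' = lawLP z + contractL ℂ (Fin.castSucc j) (lawLP zE) := by
  refine MarkedLoops.lawLP_eq_add_contractL z' z zE j fun p => ?_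
  have hz : side zE.v zE.i ∈ hBonds D := by rw [hvE, hiE]; exact z.allSides z.i
  rw [hv', hi', ← hvE, ← hiE, T.patternCount_eq_add_present hz p.1, T.presentCount_eq_sum M zE hz p]

end AttachData

end Contract

end Literature.Probability.Percolation.MarkedLoops
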